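import Summits.Ventures.HodgeRepro2.T5SU11LegendreSeriesUniform

/-!
# The rate of convergence of the Legendre series of a `C⁴` function: `sup_{[−1,1]} |f − S_d f| ≤ ‖L²f‖₂ / d³`

For `f` four times differentiable on `[−1, 1]` with continuous fourth derivative (`h₁`–`h₄`, `h₄c` below:
`f₁ = f′`, `f₂ = f″`, `f₃ = f‴`, `f₄ = f⁗`) the Sturm–Liouville operator `L f = ((1 − x²) f′)′` (row 422's
`sturm`) can be applied twice: `L f` has the derivatives `(L f)′ = (1 − x²) f‴ − 4x f″ − 2 f′` (`sturmDeriv`) and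
`(L f)″ = (1 − x²) f⁗ − 6x f‴ − 6 f″` (`sturmDeriv2`), and `L²f = L (L f)` (`sturm2`). Row 422's relation applied
twice gives

  **`c_k(f) = c_k(L²f) / (k(k + 1))²`** for `k ≥ 1`   (`fourierLegendre_eq_sturm2`),

so the tail `Σ_{k>d} |c_k(f)|` is bounded, by Cauchy–Schwarz, Bessel for `L²f` (row 420) and
`Σ_{k>d} (2k + 1)/(2 k⁴ (k + 1)⁴) ≤ Σ_{k>d} 1/k⁷ ≤ d⁻⁶` (`sum_weight_sq_le`), by `‖L²f‖₂ / d³`, and with row 423's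
error bound `|f − S_d f| ≤ Σ_{k>d} |c_k(f)|`:

  **`|f(x) − S_d f(x)| ≤ √(∫_{−1}^{1} (L²f)²) / d³` for every `x ∈ [−1, 1]` and `d ≥ 1`**
  (`abs_sub_partialSum_le_div_pow_three`, and `abs_sub_partialSum_le_div_pow_three_of_contDiff` for `f ∈ C⁴(ℝ)`):

the Legendre series of a `C⁴` function converges uniformly with the rate `O(d⁻³)` — one order better than the
`O(d⁻²)`-type bound a `C²` hypothesis alone would give by the same method — with an explicit constant, the `L²`
norm of `L²f`. Nothing is claimed about (N).

Blind lane: Mathlib + the HodgeRepro2 prefix only; no sorry; axioms ⊆ {propext, Classical.choice,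
Quot.sound}.
-/

namespace Summit.Ventures.HodgeRepro2.T5SU11LegendreSeriesRate

open Polynomial intervalIntegral Finset Filter Topology MeasureTheory
open Set (Icc Ioc Ioo uIcc uIoc EqOn)
open T5SU11SphericalLegendreAll T5SU11LegendreIdentities T5SU11LegendreOrthogonal
  T5SU11LegendreSeries T5SU11LegendreCoefficientDecay T5SU11LegendreSeriesUniform

/-! ### The iterated Sturm–Liouville operator -/

/-- **`(L f)′ = (1 − x²) f‴ − 4x f″ − 2 f′`**, the derivative of `L f = (1 − x²) f″ − 2x f′`. -/
noncomputable def sturmDeriv (f₁ f₂ f₃ : ℝ → ℝ) (x : ℝ) : ℝ := (1 - x ^ 2) * f₃ x - 4 * x * f₂ x - 2 * f₁ x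

/-- **`(L f)″ = (1 − x²) f⁗ − 6x f‴ − 6 f″`**, the second derivative of `L f`. -/
noncomputable def sturmDeriv2 (f₂ f₃ f₄ : ℝ → ℝ) (x : ℝ) : ℝ := (1 - x ^ 2) * f₄ x - 6 * x * f₃ x - 6 * f₂ x

/-- **`L²f = L (L f)`**, the Sturm–Liouville operator applied twice. -/
noncomputable def sturm2 (f₁ f₂ f₃ f₄ : ℝ → ℝ) : ℝ → ℝ :=
  T5SU11LegendreCoefficientDecay.sturm (sturmDeriv f₁ f₂ f₃) (sturmDeriv2 f₂ f₃ f₄)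

section C4

variable {f f₁ f₂ f₃ f₄ : ℝ → ℝ}
  (h₁ : ∀ x ∈ Icc (-1 : ℝ) 1, HasDerivAt f (f₁ x) x)
  (h₂ : ∀ x ∈ Icc (-1 : ℝ) 1, HasDerivAt f₁ (f₂ x) x)
  (h₃ : ∀ x ∈ Icc (-1 : ℝ) 1, HasDerivAt f₂ (f₃ x) x)
  (h₄ : ∀ x ∈ Icc (-1 : ℝ) 1, HasDerivAt f₃ (f₄ x) x)
  (h₄c : ContinuousOn f₄ (Icc (-1 : ℝ) 1))

omit h₁ h₄ h₄c in
include h₂ h₃ in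
/-- `L f` has derivative `(L f)′` at every point of `[−1, 1]`. -/
theorem hasDerivAt_sturm {x : ℝ} (hx : x ∈ Icc (-1 : ℝ) 1) :
    HasDerivAt (sturm f₁ f₂) (sturmDeriv f₁ f₂ f₃ x) x := by
  have hA := ((hasDerivAt_const x (1 : ℝ)).sub (hasDerivAt_pow 2 x)).mul (h₃ x hx)
  have hB := ((hasDerivAt_const x (2 : ℝ)).mul (hasDerivAt_id x)).mul (h₂ x hx)
  have h := hA.sub hB
  refine (h.congr_deriv ?_).congr_of_eventuallyEq (Filter.Eventually.of_forall fun y => ?_)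
  · simp only [sturmDeriv, Pi.sub_apply, Pi.mul_apply, id]
    push_cast
    ring
  · simp only [sturm, Pi.sub_apply, Pi.mul_apply, id]

omit h₁ h₄c in
include h₂ h₃ h₄ in
/-- `(L f)′` has derivative `(L f)″` at every point of `[−1, 1]`. -/
theorem hasDerivAt_sturmDeriv {x : ℝ} (hx : x ∈ Icc (-1 : ℝ) 1) :
    HasDerivAt (sturmDeriv f₁ f₂ f₃) (sturmDeriv2 f₂ f₃ f₄ x) x := by
  have hA := ((hasDerivAt_const x (1 : ℝ)).sub (hasDerivAt_pow 2 x)).mul (h₄ x hx)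
  have hB := ((hasDerivAt_const x (4 : ℝ)).mul (hasDerivAt_id x)).mul (h₃ x hx)
  have hC := (h₂ x hx).const_mul (2 : ℝ)
  have h := (hA.sub hB).sub hC
  refine (h.congr_deriv ?_).congr_of_eventuallyEq (Filter.Eventually.of_forall fun y => ?_)
  · simp only [sturmDeriv2, Pi.sub_apply, Pi.mul_apply, id]
    push_cast
    ring
  · simp only [sturmDeriv, Pi.sub_apply, Pi.mul_apply, id]

omit h₁ h₂ in
include h₃ h₄ h₄c in
/-- `(L f)″` is continuous on `[−1, 1]`. -/
theorem continuousOn_sturmDeriv2 : ContinuousOn (sturmDeriv2 f₂ f₃ f₄) (Icc (-1 : ℝ) 1) := by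
  have c₂ : ContinuousOn f₂ (Icc (-1 : ℝ) 1) := fun x hx => (h₃ x hx).continuousAt.continuousWithinAt
  have c₃ : ContinuousOn f₃ (Icc (-1 : ℝ) 1) := fun x hx => (h₄ x hx).continuousAt.continuousWithinAt
  have hA : ContinuousOn (fun x : ℝ => (1 - x ^ 2) * f₄ x) (Icc (-1 : ℝ) 1) :=
    (continuous_const.sub (continuous_pow 2)).continuousOn.mul h₄c
  have hB : ContinuousOn (fun x : ℝ => 6 * x * f₃ x) (Icc (-1 : ℝ) 1) :=
    (continuous_const.mul continuous_id).continuousOn.mul c₃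
  have hC : ContinuousOn (fun x : ℝ => 6 * f₂ x) (Icc (-1 : ℝ) 1) := c₂.const_smul (6 : ℝ)
  exact (hA.sub hB).sub hC

omit h₁ in
include h₂ h₃ h₄ h₄c in
/-- `L²f` is continuous on `[−1, 1]`. -/
theorem continuousOn_sturm2 : ContinuousOn (sturm2 f₁ f₂ f₃ f₄) (Icc (-1 : ℝ) 1) :=
  continuousOn_sturm (fun _ hx => hasDerivAt_sturmDeriv h₂ h₃ h₄ hx) (continuousOn_sturmDeriv2 h₃ h₄ h₄c)

include h₁ h₂ h₃ h₄ h₄c in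
/-- **`c_k(f) = c_k(L²f)/(k(k + 1))²`** for `k ≥ 1` (row 422's relation applied twice). -/
theorem fourierLegendre_eq_sturm2 {k : ℕ} (hk : 1 ≤ k) :
    fourierLegendre f k = fourierLegendre (sturm2 f₁ f₂ f₃ f₄) k / ((k : ℝ) * ((k : ℝ) + 1)) ^ 2 := by
  have c₂ : ContinuousOn f₂ (Icc (-1 : ℝ) 1) := fun x hx => (h₃ x hx).continuousAt.continuousWithinAt
  have e1 := fourierLegendre_eq_sturm h₁ h₂ c₂ hk
  have e2 := fourierLegendre_eq_sturm (fun _ hx => hasDerivAt_sturm h₂ h₃ hx)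
    (fun _ hx => hasDerivAt_sturmDeriv h₂ h₃ h₄ hx) (continuousOn_sturmDeriv2 h₃ h₄ h₄c) hk
  rw [e1, e2, sturm2]
  have hne : (k : ℝ) * ((k : ℝ) + 1) ≠ 0 := by
    have : (1 : ℝ) ≤ (k : ℝ) := by exact_mod_cast hk
    positivity
  field_simp

/-! ### The weight sums -/

/-- `Σ_{k<n} 1/(k + d + 1)² ≤ 1/d − 1/(n + d)` (telescoping), for `d ≥ 1`. -/
theorem sum_inv_sq_shift_le {d : ℕ} (hd : 1 ≤ d) (n : ℕ) :
    ∑ k ∈ range n, (1 : ℝ) / ((k : ℝ) + d + 1) ^ 2 ≤ 1 / d - 1 / ((n : ℝ) + d) := by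
  induction n with
  | zero => simp
  | succ n ih =>
    rw [Finset.sum_range_succ]
    have hd' : (1 : ℝ) ≤ (d : ℝ) := by exact_mod_cast hd
    have hpos : (0 : ℝ) < (n : ℝ) + d := by positivity
    have hstep : (1 : ℝ) / ((n : ℝ) + d + 1) ^ 2 ≤ 1 / ((n : ℝ) + d) - 1 / ((n : ℝ) + d + 1) := by
      rw [div_sub_div _ _ hpos.ne' (by positivity), div_le_div_iff₀ (by positivity) (by positivity)]
      nlinarith
    push_cast
    have e : (1 : ℝ) / ((n : ℝ) + 1 + d) = 1 / ((n : ℝ) + d + 1) := by ring_nf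
    rw [e]
    linarith

/-- The weight `w_j = √((2j + 1)/2)/(j(j + 1))²` satisfies `w_j² ≤ 1/j⁷` (`j ≥ 1`). -/
theorem weight_sq_le {j : ℕ} (hj : 1 ≤ j) :
    (Real.sqrt ((2 * (j : ℝ) + 1) / 2) / ((j : ℝ) * ((j : ℝ) + 1)) ^ 2) ^ 2 ≤ 1 / (j : ℝ) ^ 7 := by
  have hj' : (1 : ℝ) ≤ (j : ℝ) := by exact_mod_cast hj
  rw [div_pow, Real.sq_sqrt (by positivity), div_le_div_iff₀ (by positivity) (by positivity)]
  -- `(2j + 1)/2 · j⁷ ≤ (j(j + 1))⁴`, i.e. `(2j + 1) j⁷ ≤ 2 j⁴ (j + 1)⁴`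
  have h1 : (2 * (j : ℝ) + 1) * (j : ℝ) ^ 3 ≤ 2 * ((j : ℝ) + 1) ^ 4 := by nlinarith [sq_nonneg (j : ℝ)]
  have h2 : (((j : ℝ) * ((j : ℝ) + 1)) ^ 2) ^ 2 = (j : ℝ) ^ 4 * ((j : ℝ) + 1) ^ 4 := by ring
  rw [h2, one_mul]
  have h3 : (0 : ℝ) ≤ (j : ℝ) ^ 4 := by positivity
  have h4 : (2 * (j : ℝ) + 1) * (j : ℝ) ^ 7 ≤ 2 * ((j : ℝ) ^ 4 * ((j : ℝ) + 1) ^ 4) := by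
    have := mul_le_mul_of_nonneg_left h1 h3
    nlinarith [this]
  linarith

/-- **`Σ_{k<n} w_{k+d+1}² ≤ 1/d⁶`** for `d ≥ 1`: the shifted weight sums are `O(d⁻⁶)`. -/
theorem sum_weight_sq_le {d : ℕ} (hd : 1 ≤ d) (n : ℕ) :
    ∑ k ∈ range n, (Real.sqrt ((2 * ((k + (d + 1) : ℕ) : ℝ) + 1) / 2)
        / (((k + (d + 1) : ℕ) : ℝ) * (((k + (d + 1) : ℕ) : ℝ) + 1)) ^ 2) ^ 2 ≤ 1 / (d : ℝ) ^ 6 := by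
  have hd' : (1 : ℝ) ≤ (d : ℝ) := by exact_mod_cast hd
  calc ∑ k ∈ range n, (Real.sqrt ((2 * ((k + (d + 1) : ℕ) : ℝ) + 1) / 2)
          / (((k + (d + 1) : ℕ) : ℝ) * (((k + (d + 1) : ℕ) : ℝ) + 1)) ^ 2) ^ 2
      ≤ ∑ k ∈ range n, 1 / (d : ℝ) ^ 5 * (1 / ((k : ℝ) + d + 1) ^ 2) := by
        refine Finset.sum_le_sum fun k _ => ?_
        refine (weight_sq_le (by omega)).trans ?_
        push_cast
        rw [show (k : ℝ) + ((d : ℝ) + 1) = (k : ℝ) + d + 1 by ring]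
        have hk : (d : ℝ) ≤ (k : ℝ) + d + 1 := by linarith [(Nat.cast_nonneg k : (0 : ℝ) ≤ k)]
        have hpos : (0 : ℝ) < (k : ℝ) + d + 1 := by positivity
        rw [div_mul_div_comm, one_mul, div_le_div_iff₀ (by positivity) (by positivity), one_mul, one_mul]
        calc (d : ℝ) ^ 5 * ((k : ℝ) + d + 1) ^ 2 ≤ ((k : ℝ) + d + 1) ^ 5 * ((k : ℝ) + d + 1) ^ 2 :=
              mul_le_mul_of_nonneg_right (pow_le_pow_left₀ (by positivity) hk 5) (by positivity)
          _ = ((k : ℝ) + d + 1) ^ 7 := by ring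
    _ = 1 / (d : ℝ) ^ 5 * ∑ k ∈ range n, 1 / ((k : ℝ) + d + 1) ^ 2 := by rw [Finset.mul_sum]
    _ ≤ 1 / (d : ℝ) ^ 5 * (1 / d) := by
        refine mul_le_mul_of_nonneg_left ((sum_inv_sq_shift_le hd n).trans ?_) (by positivity)
        have : (0 : ℝ) ≤ 1 / ((n : ℝ) + d) := by positivity
        linarith
    _ = 1 / (d : ℝ) ^ 6 := by
        field_simp

/-- A shifted partial sum of a non-negative sequence is bounded by a longer initial partial sum. -/
theorem sum_shift_le {F : ℕ → ℝ} (hF : ∀ j, 0 ≤ F j) (d n : ℕ) :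
    ∑ k ∈ range n, F (k + (d + 1)) ≤ ∑ j ∈ range (n + (d + 1)), F j := by
  induction n with
  | zero => exact Finset.sum_nonneg fun j _ => hF j
  | succ n ih =>
    rw [Finset.sum_range_succ, show n + 1 + (d + 1) = n + (d + 1) + 1 by ring, Finset.sum_range_succ]
    exact add_le_add ih le_rfl

/-! ### The rate -/

include h₁ h₂ h₃ h₄ h₄c in
/-- **The tail of the coefficient series of a `C⁴` function**: `Σ_{k<n} |c_{k+d+1}(f)| ≤ √(∫ (L²f)²) / d³` for
every `n` (`d ≥ 1`): Cauchy–Schwarz with the factorisation `|c_j(f)| = (|c_j(L²f)| √(2/(2j+1))) · w_j`, Bessel for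
`L²f`, and `Σ w_j² ≤ d⁻⁶`. -/
theorem sum_abs_fourierLegendre_shift_le {d : ℕ} (hd : 1 ≤ d) (n : ℕ) :
    ∑ k ∈ range n, |fourierLegendre f (k + (d + 1))|
      ≤ Real.sqrt (∫ x in (-1 : ℝ)..1, sturm2 f₁ f₂ f₃ f₄ x ^ 2) / (d : ℝ) ^ 3 := by
  set g := sturm2 f₁ f₂ f₃ f₄ with hg
  have hgc : ContinuousOn g (Icc (-1 : ℝ) 1) := continuousOn_sturm2 h₂ h₃ h₄ h₄c
  have hd' : (1 : ℝ) ≤ (d : ℝ) := by exact_mod_cast hd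
  -- the factorisation
  have hfac : ∀ k ∈ range n, |fourierLegendre f (k + (d + 1))|
      = (|fourierLegendre g (k + (d + 1))| * Real.sqrt (2 / (2 * ((k + (d + 1) : ℕ) : ℝ) + 1)))
        * (Real.sqrt ((2 * ((k + (d + 1) : ℕ) : ℝ) + 1) / 2)
          / (((k + (d + 1) : ℕ) : ℝ) * (((k + (d + 1) : ℕ) : ℝ) + 1)) ^ 2) := by
    intro k _
    have hk1 : 1 ≤ k + (d + 1) := by omega
    have hkpos : (0 : ℝ) < (((k + (d + 1) : ℕ) : ℝ) * (((k + (d + 1) : ℕ) : ℝ) + 1)) ^ 2 := by positivity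
    rw [fourierLegendre_eq_sturm2 h₁ h₂ h₃ h₄ h₄c hk1, abs_div, abs_of_pos hkpos]
    have hs : Real.sqrt (2 / (2 * ((k + (d + 1) : ℕ) : ℝ) + 1))
        * Real.sqrt ((2 * ((k + (d + 1) : ℕ) : ℝ) + 1) / 2) = 1 := by
      rw [← Real.sqrt_mul (by positivity)]
      have : (2 / (2 * ((k + (d + 1) : ℕ) : ℝ) + 1)) * ((2 * ((k + (d + 1) : ℕ) : ℝ) + 1) / 2) = 1 := by
        field_simp
      rw [this, Real.sqrt_one]
    calc |fourierLegendre g (k + (d + 1))| / (((k + (d + 1) : ℕ) : ℝ) * (((k + (d + 1) : ℕ) : ℝ) + 1)) ^ 2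
        = |fourierLegendre g (k + (d + 1))|
            * (Real.sqrt (2 / (2 * ((k + (d + 1) : ℕ) : ℝ) + 1))
              * Real.sqrt ((2 * ((k + (d + 1) : ℕ) : ℝ) + 1) / 2))
            / (((k + (d + 1) : ℕ) : ℝ) * (((k + (d + 1) : ℕ) : ℝ) + 1)) ^ 2 := by rw [hs, mul_one]
      _ = _ := by ring
  -- Cauchy–Schwarz
  rw [Finset.sum_congr rfl hfac]
  refine (Real.sum_mul_le_sqrt_mul_sqrt _ _ _).trans ?_
  -- Bessel for `g`
  have hB : ∑ k ∈ range n, (|fourierLegendre g (k + (d + 1))|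
      * Real.sqrt (2 / (2 * ((k + (d + 1) : ℕ) : ℝ) + 1))) ^ 2 ≤ ∫ x in (-1 : ℝ)..1, g x ^ 2 := by
    have e : ∀ k ∈ range n, (|fourierLegendre g (k + (d + 1))|
        * Real.sqrt (2 / (2 * ((k + (d + 1) : ℕ) : ℝ) + 1))) ^ 2
        = fourierLegendre g (k + (d + 1)) ^ 2 * (2 / (2 * ((k + (d + 1) : ℕ) : ℝ) + 1)) := by
      intro k _
      rw [mul_pow, sq_abs, Real.sq_sqrt (by positivity)]
    rw [Finset.sum_congr rfl e]
    refine (sum_shift_le (F := fun j => fourierLegendre g j ^ 2 * (2 / (2 * (j : ℝ) + 1)))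
      (fun j => by positivity) d n).trans ?_
    have := bessel hgc (n + d)
    rwa [show n + d + 1 = n + (d + 1) by ring] at this
  have hW := sum_weight_sq_le hd n
  have hBnn : 0 ≤ ∫ x in (-1 : ℝ)..1, g x ^ 2 := integral_nonneg (by norm_num) fun x _ => sq_nonneg _
  calc Real.sqrt (∑ k ∈ range n, (|fourierLegendre g (k + (d + 1))|
          * Real.sqrt (2 / (2 * ((k + (d + 1) : ℕ) : ℝ) + 1))) ^ 2)
        * Real.sqrt (∑ k ∈ range n, (Real.sqrt ((2 * ((k + (d + 1) : ℕ) : ℝ) + 1) / 2)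
          / (((k + (d + 1) : ℕ) : ℝ) * (((k + (d + 1) : ℕ) : ℝ) + 1)) ^ 2) ^ 2)
      ≤ Real.sqrt (∫ x in (-1 : ℝ)..1, g x ^ 2) * Real.sqrt (1 / (d : ℝ) ^ 6) := by gcongr
    _ = Real.sqrt (∫ x in (-1 : ℝ)..1, g x ^ 2) / (d : ℝ) ^ 3 := by
        have : Real.sqrt (1 / (d : ℝ) ^ 6) = 1 / (d : ℝ) ^ 3 := by
          rw [show (1 : ℝ) / (d : ℝ) ^ 6 = (1 / (d : ℝ) ^ 3) ^ 2 by ring]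
          exact Real.sqrt_sq (by positivity)
        rw [this]
        ring

include h₁ h₂ h₃ h₄ h₄c in
/-- **THE RATE `O(d⁻³)`**: `|f(x) − S_d f(x)| ≤ √(∫_{−1}^{1} (L²f)²) / d³` for every `x ∈ [−1, 1]` and `d ≥ 1`. -/
theorem abs_sub_partialSum_le_div_pow_three {d : ℕ} (hd : 1 ≤ d) {x : ℝ} (hx : x ∈ Icc (-1 : ℝ) 1) :
    |f x - partialSum f d x| ≤ Real.sqrt (∫ x in (-1 : ℝ)..1, sturm2 f₁ f₂ f₃ f₄ x ^ 2) / (d : ℝ) ^ 3 := by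
  have c₂ : ContinuousOn f₂ (Icc (-1 : ℝ) 1) := fun x hx => (h₃ x hx).continuousAt.continuousWithinAt
  refine (abs_sub_partialSum_le h₁ h₂ c₂ d hx).trans ?_
  exact Real.tsum_le_of_sum_range_le (fun k => abs_nonneg _)
    fun n => sum_abs_fourierLegendre_shift_le h₁ h₂ h₃ h₄ h₄c hd n

end C4

/-! ### Every `C⁴` function on `ℝ` -/

/-- The derivative data of an `f ∈ C⁴(ℝ)`: the iterated derivatives `deriv^[j] f`, `j ≤ 4`. -/
theorem hasDerivAt_of_contDiff4 {f : ℝ → ℝ} (hf : ContDiff ℝ 4 f) :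
    (∀ x ∈ Icc (-1 : ℝ) 1, HasDerivAt f (deriv f x) x) ∧
      (∀ x ∈ Icc (-1 : ℝ) 1, HasDerivAt (deriv f) (deriv^[2] f x) x) ∧
        (∀ x ∈ Icc (-1 : ℝ) 1, HasDerivAt (deriv^[2] f) (deriv^[3] f x) x) ∧
          (∀ x ∈ Icc (-1 : ℝ) 1, HasDerivAt (deriv^[3] f) (deriv^[4] f x) x) ∧
            ContinuousOn (deriv^[4] f) (Icc (-1 : ℝ) 1) := by
  have h1 : ContDiff ℝ 3 (deriv f) := by simpa using hf.iterate_deriv' 3 1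
  have h2 : ContDiff ℝ 2 (deriv^[2] f) := by simpa using hf.iterate_deriv' 2 2
  have h3 : ContDiff ℝ 1 (deriv^[3] f) := by simpa using hf.iterate_deriv' 1 3
  have h4 : Continuous (deriv^[4] f) := by simpa using (hf.iterate_deriv' 0 4).continuous
  refine ⟨fun x _ => (hf.differentiable (by norm_num) x).hasDerivAt,
    fun x _ => (h1.differentiable (by norm_num) x).hasDerivAt,
    fun x _ => ?_, fun x _ => ?_, h4.continuousOn⟩
  · have := (h2.differentiable (by norm_num) x).hasDerivAt
    have e : deriv (deriv^[2] f) x = deriv^[3] f x := (congrFun (Function.iterate_succ_apply' deriv 2 f) x).symm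
    rwa [e] at this
  · have := (h3.differentiable one_ne_zero x).hasDerivAt
    have e : deriv (deriv^[3] f) x = deriv^[4] f x := (congrFun (Function.iterate_succ_apply' deriv 3 f) x).symm
    rwa [e] at this

/-- **The rate `O(d⁻³)` for every `f ∈ C⁴(ℝ)`**, with `L²f` built from `deriv^[j] f`. -/
theorem abs_sub_partialSum_le_div_pow_three_of_contDiff {f : ℝ → ℝ} (hf : ContDiff ℝ 4 f) {d : ℕ} (hd : 1 ≤ d)
    {x : ℝ} (hx : x ∈ Icc (-1 : ℝ) 1) :
    |f x - partialSum f d x|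
      ≤ Real.sqrt (∫ x in (-1 : ℝ)..1, sturm2 (deriv f) (deriv^[2] f) (deriv^[3] f) (deriv^[4] f) x ^ 2)
        / (d : ℝ) ^ 3 :=
  let ⟨h₁, h₂, h₃, h₄, h₄c⟩ := hasDerivAt_of_contDiff4 hf
  abs_sub_partialSum_le_div_pow_three h₁ h₂ h₃ h₄ h₄c hd hx

end Summit.Ventures.HodgeRepro2.T5SU11LegendreSeriesRate
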